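import Literature.MathematicalPhysics.QuantumFieldTheory.Balaban1983to89.B5Eq178Torus
import Literature.MathematicalPhysics.QuantumFieldTheory.Balaban1983to89.B5Eq199QGQTorus

/-!
# `Balaban1983to89.B5Eq181GTorus` — T. Bałaban, *Propagators and renormalization transformations for
# lattice gauge theories. I*, Commun. Math. Phys. **95** (1984) 17–40 [Balaban1984PropagatorsI]:
# the explicit position-space formula (1.81) for `G = Δ_a⁻¹` on `J ⊥ 1` and (1.82) `GJ = GJ′ + a⁻¹J₀`
# («This gives the solution of Eq. (1.73), so G = Δ_a⁻¹»), PROVED for the concrete torus operators, and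
# their identity with the tree's momentum-representation operator (1.83)

statement-level skeleton of published theorems with citation tags; proofs where landed; nothing here is a claim about the Yang–Mills mass gap

PDF held: `paper:balaban1984-cmp95-propagators-rt-i` (journal page = PDF page + 16); pp. 30–31 read this
session from the page renders `1984-cmp95-propagators-rt-I-p014-x4.png`, `-p015-x4.png` (not from OCR).

WHAT IS REPRODUCED.  SKELETON row **B5.Eq1.81** ((1.73)–(1.82)) of
`run/shared/lean/pub/lit-balaban/SKELETON.md`, members **(1.81)** and **(1.82)**, IN POSITION SPACE for the
typed torus operators (`G = (B5DeltaA169.DeltaA)⁻¹`).  The row is «proved-existing» FIBREWISE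
(`B5Prop11Inverse`: the momentum blocks (1.83) invert the fibres of `Δ_a`); what is added here is the
x-space operator that the right-hand side of (1.81) «defines», its derivation by the printed road
(1.78) + (1.80) (file 1/2 `B5Eq178Torus` and `B5Eq194DivG.eq180`), its identity with `Δ_a⁻¹` ((1.82), «so
G = Δ_a⁻¹») and with the tree's (1.83) operator `B5Prop11Plancherel.calG`.  File 2/2 of Phase-2 seat **p37**
(gen 4) of `PHASE2-TARGETS.md` §G (cell `lit-balaban`, unit `lit-balaban-p37`, HOME
`run/shared/lean/pub/lit-balaban/`); the follow-up named in this seat's gen-3 HANDOFF.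

## The printed text (p. 31; verbatim)

«Substituting it [(1.80)] in Eq. (1.78), we obtain finally
  A = (Δ⁻¹ − aΔ⁻¹Q*φ⁻¹QΔ⁻¹)J + [(Q′Δ⁻²Q′*)⁻¹Q′Δ⁻²∂* − a∂₁*φ⁻¹QΔ⁻¹]* a⁻¹(∂₁*φ⁻¹∂₁)⁻¹
        · [(Q′Δ⁻²Q′*)⁻¹Q′Δ⁻²∂* − a∂₁*φ⁻¹QΔ⁻¹]J   (1.81)
for J satisfying ⟨1, J_μ⟩ = 0. Then the solution A satisfies also ⟨1, A_μ⟩ = 0. The right-hand side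
of (1.81) defines the operator G on such functions J. For arbitrary J we take the decomposition
J = J′ + J₀, J₀ constant, J′ orthogonal to constant functions, and we put
  GJ = GJ′ + a⁻¹J₀.   (1.82)
This gives the solution of Eq. (1.73), so G = Δ_a⁻¹. To investigate better the operator G we write it
in momentum representation: … (1.83)».

## Dictionary (the tree's typed torus operators; `T_η = Tor (fine n M)`, unit lattice `T₁^{(k)} = Tor M`,
`n = L^k`, any `d`, `n ≥ 1`, `M_μ ≥ 1`, `a > 0`)

`∂ = GradOp (fine n M) n`, `∂* = ∂ᴴ`, `∂₁ = GradOp M 1`, `∂₁* = ∂₁ᴴ`, scalar `Δ⁻¹ = LapSinv (fine n M) n`,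
`Δ⁻² = Δ⁻¹Δ⁻¹`, componentwise `Δ⁻¹ = B5Phi162Torus.LapVinv` (value `0` on constants, p. 22), `Q = QvOp`,
`Q* = QvAdj = n^d•Qᴴ`, `Q′ = QsOp`, `Q′* = B5Hk160Torus.QsAdj = n^d•Q′ᴴ` (adjoints for the (1.21)-weighted
scalar products `⟨f,g⟩_{T_η} = η^dΣf̄g`, `⟨·,·⟩_{T₁}` unweighted), `(Q′Δ⁻²Q′*)⁻¹ = B5Hk160Torus.Einv` (on
`1^⊥`), `φ = B5Phi176Torus.Phi176` ((1.76)), `φ⁻¹ = Phi176Inv`, `(∂₁*φ⁻¹∂₁)⁻¹ = GPhiEInv` (on `1^⊥`),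
`Δ_a = B5DeltaA169.DeltaA` ((1.69)/(1.73)), `G = (DeltaA)⁻¹` ((1.71)), `P₀ = B5Hk160Torus.P0M` (the
componentwise constant-mode projection: `P₀J = J₀ = B0 J`, `(1 − P₀)J = J′ = Bp J`).  NEW (defs with
bodies): **`K181`** = the square bracket `[(Q′Δ⁻²Q′*)⁻¹Q′Δ⁻²∂* − a∂₁*φ⁻¹QΔ⁻¹]` of (1.81) (vector functions on
`T_η` → scalars on `T₁^{(k)}`), **`K181adj`** `:= n^d•(K181)ᴴ` = its adjoint `[…]*` for the weighted scalar
products, **`G181`** = the right-hand side of (1.81) as an operator, **`G182`** `:= G181(1 − P₀) + a⁻¹P₀`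
= (1.82).

## What is certified (kernel, zero `sorry`, axioms ⊆ {propext, Classical.choice, Quot.sound})

* §1 the operators: `K181_mulVec`; **`K181adj_eq`**: `[…]* = ∂Δ⁻²Q′*(Q′Δ⁻²Q′*)⁻¹ − aΔ⁻¹Q*φ⁻¹∂₁` — the
  coefficient of `Q′Δ⁻¹∂*A` in (1.78) (`Δ⁻¹`, `(Q′Δ⁻²Q′*)⁻¹`, `φ⁻¹` Hermitian; `(∂*)* = ∂`, `Q** = Q` with the
  weights); **`K181_adjoint`**: `⟨[…]J, t⟩_{T₁} = ⟨J, […]*t⟩_{T_η}` — the printed `*` IS the adjoint for the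
  scalar products (1.21); `G181_mulVec`.
* §2 **(1.81)** `eq181`: `(DeltaA)⁻¹ *ᵥ J = G181 *ᵥ J` for EVERY `J ⊥` constants (`a > 0`) — «Substituting
  it in Eq. (1.78)»: from (1.78) `B5Eq178Torus.eq178` and (1.80) `B5Eq194DivG.eq180` exactly as printed (the
  bracket of (1.80) is `a⁻¹[…]J`, the coefficient of `Q′Δ⁻¹∂*A` in (1.78) is `[…]*`); `eq181_of_solution`
  (the display with `A` the solution of (1.73)); «Then the solution A satisfies also ⟨1, A_μ⟩ = 0»
  (`orthConst_G_mulVec`, = (1.74)); and `G181` maps every `J` into `1^⊥` (`orthConst_G181_mulVec`).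
* §3 **(1.82)** `eq182_mulVec`: `GJ = G181 J′ + a⁻¹J₀` for EVERY `J` (`GJ₀ = a⁻¹J₀` is
  `B5Phi176Torus.G_constV`); the matrix form **`eq182 : (DeltaA)⁻¹ = G182`**; «This gives the solution of
  Eq. (1.73), so G = Δ_a⁻¹» (`DeltaA_G182_mulVec`, `DeltaA_mul_G182`, `G182_mul_DeltaA`); and the bridge to
  the momentum representation (1.83): **`G182_eq_calG : G182 = B5Prop11Plancherel.calG`** (the operator
  whose Fourier blocks over the cosets `p = p′ + l` are the matrices (1.83); via
  `B5DeltaA169.calG_eq_DeltaA_inv`) — i.e. the x-space (1.81)/(1.82) and the tree's (1.83) are ONE operator.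

HONEST SCOPE.  Finite torus (periods `n·M_μ`) instead of the printed `T_η` with `L′_μ → ∞`; complex fields;
unitary DFT; `Δ⁻¹`, `(Q′Δ⁻²Q′*)⁻¹`, `(∂₁*φ⁻¹∂₁)⁻¹` are the tree's inverses ON THE SUBSPACES ORTHOGONAL TO
CONSTANTS (value `0`, resp. `n^{-d}Minv`, on constants), as the paper uses them, and every argument they
receive in (1.81)–(1.82) is certified to lie there (`A ⊥ 1` by (1.74), `Q′Δ⁻¹∂*A ⊥ 1`).  (1.83) itself is
NOT re-transcribed (decls of record: `B5Prop11Inverse.G_eq`, `B5Prop11Plancherel.calG`,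
`B5G183Kernel.calG_apply`); the passage (1.81) → (1.83) is certified WITHOUT retracing the symbol
computation, through `G = Δ_a⁻¹` on both sides.  NOT summit progress.
-/

open scoped BigOperators Matrix ComplexConjugate
open Finset Complex

namespace Literature.MathematicalPhysics.QuantumFieldTheory.Balaban1983to89.B5Eq181GTorus

open Literature.MathematicalPhysics.QuantumFieldTheory.Balaban1983to89
open Literature.MathematicalPhysics.QuantumFieldTheory.Balaban1983to89.B5Prop11Plancherel (Tor dft fine calG)
open Literature.MathematicalPhysics.QuantumFieldTheory.Balaban1983to89.B5Prop11Lower (Lap)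
open Literature.MathematicalPhysics.QuantumFieldTheory.Balaban1983to89.B5Action121 (comp LapS GradOp
  star_mulVec_dotProduct)
open Literature.MathematicalPhysics.QuantumFieldTheory.Balaban1983to89.B5Block118 (QsOp QvOp)
open Literature.MathematicalPhysics.QuantumFieldTheory.Balaban1983to89.B5LaplaceInverse (LapSinv
  LapSinv_conjTranspose sum_LapSinv)
open Literature.MathematicalPhysics.QuantumFieldTheory.Balaban1983to89.B5DeltaA169 (QvAdj DeltaA isUnit_DeltaA
  calG_eq_DeltaA_inv)
open Literature.MathematicalPhysics.QuantumFieldTheory.Balaban1983to89.B5Value126 (Minv_conjTranspose)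
open Literature.MathematicalPhysics.QuantumFieldTheory.Balaban1983to89.B5Phi162Torus (liftV OrthConst LapVinv
  comp_LapVinv_mulVec)
open Literature.MathematicalPhysics.QuantumFieldTheory.Balaban1983to89.B5Hk160Torus (orthConst_GradOp constV
  orthConst_sub B0 Bp orthConst_Bp Bp_add_B0 P0M P0M_mulVec QsAdj Einv)
open Literature.MathematicalPhysics.QuantumFieldTheory.Balaban1983to89.B5Phi176Torus (Phi176Inv GPhiEInv
  orthConst_of_DeltaA_eq G_constV)
open Literature.MathematicalPhysics.QuantumFieldTheory.Balaban1983to89.B5Eq194DivG (eq180)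
open Literature.MathematicalPhysics.QuantumFieldTheory.Balaban1983to89.B5Eq199QGQTorus (Phi176Inv_isHermitian)
open Literature.MathematicalPhysics.QuantumFieldTheory.Balaban1983to89.B5Eq178Torus (eq178)
open Literature.MathematicalPhysics.QuantumFieldTheory.Balaban1983to89.Beta.VectorPropagatorDict
  (ext_of_mulVec')

noncomputable section

variable {d : ℕ} (n : ℕ) [NeZero n] (M : Fin d → ℕ) [hM : ∀ μ, NeZero (M μ)] (a : ℝ)

/-! ## §0 Small tools -/

omit [NeZero n] hM in
/-- `(liftV L)ᴴ = liftV (Lᴴ)` (componentwise operators). [folklore] -/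
private theorem liftV_conjTranspose {N : Fin d → ℕ} (L : Fin d → Matrix (Tor N) (Tor N) ℂ) :
    (liftV N L)ᴴ = liftV N fun μ => (L μ)ᴴ := by
  ext i j
  simp only [liftV, Matrix.conjTranspose_apply]
  by_cases h : i.2 = j.2
  · rw [if_pos h, if_pos h.symm, h]
  · rw [if_neg h, if_neg (Ne.symm h), star_zero]

/-- the componentwise `Δ⁻¹` is Hermitian (a real Fourier multiplier). [folklore] -/
private theorem LapVinv_conjTranspose : (LapVinv n M)ᴴ = LapVinv n M := by
  rw [LapVinv, liftV_conjTranspose]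
  simp only [LapSinv_conjTranspose]

/-- `(Q′Δ⁻²Q′*)⁻¹` is Hermitian (`Einv = n^{-d}•Minv`, `Minv` Hermitian). [folklore] -/
private theorem Einv_conjTranspose : (Einv n M)ᴴ = Einv n M := by
  rw [Einv, Matrix.conjTranspose_smul, Minv_conjTranspose, star_inv₀, star_pow, Complex.star_def,
    Complex.conj_natCast]

/-- `Δ⁻¹V ⊥` constants for every vector field `V` (the multiplier vanishes on the zero mode). [folklore] -/
private theorem orthConst_LapVinv (V : Tor (fine n M) × Fin d → ℂ) : OrthConst (fine n M) (LapVinv n M *ᵥ V) := by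
  intro μ
  have h := sum_LapSinv (fine n M) (n : ℂ) (comp (fine n M) V μ)
  rw [← comp_LapVinv_mulVec] at h
  exact h

omit [NeZero n] hM in
/-- `OrthConst` is preserved under addition. [folklore] -/
private theorem orthConst_add {N : Fin d → ℕ} [∀ ν, NeZero (N ν)] {u v : Tor N × Fin d → ℂ}
    (hu : OrthConst N u) (hv : OrthConst N v) : OrthConst N (u + v) := by
  intro μ
  simp only [Pi.add_apply, Finset.sum_add_distrib, hu μ, hv μ, add_zero]

omit [NeZero n] hM in
/-- `OrthConst` is preserved under scalar multiplication. [folklore] -/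
private theorem orthConst_smul {N : Fin d → ℕ} [∀ ν, NeZero (N ν)] (c : ℂ) {u : Tor N × Fin d → ℂ}
    (hu : OrthConst N u) : OrthConst N (c • u) := by
  intro μ
  simp only [Pi.smul_apply, smul_eq_mul, ← Finset.mul_sum, hu μ, mul_zero]

/-! ## §1 The operators of (1.81): the bracket `[…]`, its adjoint `[…]*`, and the right-hand side -/

/-- the square bracket of (1.81): **`[(Q′Δ⁻²Q′*)⁻¹Q′Δ⁻²∂* − a∂₁*φ⁻¹QΔ⁻¹]`** (vector functions on `T_η` →
scalar functions on the unit lattice). [cite: Balaban1984PropagatorsI, (1.81) p.31] -/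
def K181 : Matrix (Tor M) (Tor (fine n M) × Fin d) ℂ :=
  Einv n M * QsOp n M * LapSinv (fine n M) (n : ℂ) * LapSinv (fine n M) (n : ℂ) * (GradOp (fine n M) (n : ℂ))ᴴ
    - (a : ℂ) • ((GradOp M 1)ᴴ * Phi176Inv n M a * QvOp n M * LapVinv n M)

/-- `[…]J = (Q′Δ⁻²Q′*)⁻¹Q′Δ⁻²∂*J − a∂₁*φ⁻¹QΔ⁻¹J`. [cite: Balaban1984PropagatorsI, (1.81) p.31] -/
theorem K181_mulVec (J : Tor (fine n M) × Fin d → ℂ) :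
    K181 n M a *ᵥ J
      = Einv n M *ᵥ (QsOp n M *ᵥ (LapSinv (fine n M) (n : ℂ) *ᵥ (LapSinv (fine n M) (n : ℂ) *ᵥ
          ((GradOp (fine n M) (n : ℂ))ᴴ *ᵥ J))))
        - (a : ℂ) • ((GradOp M 1)ᴴ *ᵥ (Phi176Inv n M a *ᵥ (QvOp n M *ᵥ (LapVinv n M *ᵥ J)))) := by
  simp only [K181, Matrix.sub_mulVec, Matrix.smul_mulVec, ← Matrix.mulVec_mulVec]

/-- the printed **`[…]*`**: the adjoint of `K181` for the scalar products (1.21) (`⟨·,·⟩_{T_η}` carries the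
weight `η^d = n^{-d}`, `⟨·,·⟩_{T₁}` is unweighted), i.e. `n^d•(K181)ᴴ`. [cite: Balaban1984PropagatorsI, (1.81) p.31, (1.21) p.21] -/
def K181adj : Matrix (Tor (fine n M) × Fin d) (Tor M) ℂ := ((n : ℂ) ^ d) • (K181 n M a)ᴴ

/-- **`[…]* = ∂Δ⁻²Q′*(Q′Δ⁻²Q′*)⁻¹ − aΔ⁻¹Q*φ⁻¹∂₁`** — exactly the coefficient of `Q′Δ⁻¹∂*A` in (1.78)
(`Δ⁻¹`, `(Q′Δ⁻²Q′*)⁻¹`, `φ⁻¹` Hermitian; `(∂*)* = ∂`, `(∂₁*)* = ∂₁`, `(Q′)* = Q′*`, `Q** = Q` with the weights).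
[cite: Balaban1984PropagatorsI, (1.78) p.30, (1.81) p.31] -/
theorem K181adj_eq :
    K181adj n M a
      = GradOp (fine n M) (n : ℂ) * LapSinv (fine n M) (n : ℂ) * LapSinv (fine n M) (n : ℂ) * QsAdj n M * Einv n M
        - (a : ℂ) • (LapVinv n M * QvAdj n M * Phi176Inv n M a * GradOp M 1) := by
  rw [K181adj, K181, Matrix.conjTranspose_sub, Matrix.conjTranspose_smul, smul_sub]
  simp only [Matrix.conjTranspose_mul, Matrix.conjTranspose_conjTranspose, LapSinv_conjTranspose,
    Einv_conjTranspose, LapVinv_conjTranspose, (Phi176Inv_isHermitian n M a).eq, Complex.star_def,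
    Complex.conj_ofReal, QsAdj, QvAdj, Matrix.smul_mul, Matrix.mul_smul, Matrix.mul_assoc, smul_smul,
    mul_comm ((n : ℂ) ^ d) (a : ℂ)]

/-- `[…]*t = ∂Δ⁻²Q′*(Q′Δ⁻²Q′*)⁻¹t − aΔ⁻¹Q*φ⁻¹∂₁t`. [cite: Balaban1984PropagatorsI, (1.81) p.31] -/
theorem K181adj_mulVec (t : Tor M → ℂ) :
    K181adj n M a *ᵥ t
      = GradOp (fine n M) (n : ℂ) *ᵥ (LapSinv (fine n M) (n : ℂ) *ᵥ (LapSinv (fine n M) (n : ℂ) *ᵥ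
          (QsAdj n M *ᵥ (Einv n M *ᵥ t))))
        - (a : ℂ) • (LapVinv n M *ᵥ (QvAdj n M *ᵥ (Phi176Inv n M a *ᵥ (GradOp M 1 *ᵥ t)))) := by
  simp only [K181adj_eq, Matrix.sub_mulVec, Matrix.smul_mulVec, ← Matrix.mulVec_mulVec]

/-- **the printed `*` IS the adjoint** for the scalar products (1.21): `⟨[…]J, t⟩_{T₁} = ⟨J, […]*t⟩_{T_η}`, i.e.
`Σ_y conj(([…]J)(y))·t(y) = η^d Σ_{x,μ} conj(J_μ(x))·([…]*t)_μ(x)`, `η^d = n^{-d}`.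
[cite: Balaban1984PropagatorsI, (1.21) p.21, (1.81) p.31] -/
theorem K181_adjoint (J : Tor (fine n M) × Fin d → ℂ) (t : Tor M → ℂ) :
    star (K181 n M a *ᵥ J) ⬝ᵥ t = ((n : ℂ) ^ d)⁻¹ * (star J ⬝ᵥ (K181adj n M a *ᵥ t)) := by
  have hnd : ((n : ℂ) ^ d) ≠ 0 := pow_ne_zero _ (by exact_mod_cast NeZero.ne n)
  rw [star_mulVec_dotProduct, K181adj, Matrix.smul_mulVec, dotProduct_smul, smul_eq_mul, ← mul_assoc,
    inv_mul_cancel₀ hnd, one_mul]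

/-- **the right-hand side of (1.81) as an operator**:
`G181 = (Δ⁻¹ − aΔ⁻¹Q*φ⁻¹QΔ⁻¹) + […]*·a⁻¹(∂₁*φ⁻¹∂₁)⁻¹·[…]` («The right-hand side of (1.81) defines the
operator G on such functions J»). [cite: Balaban1984PropagatorsI, (1.81) p.31] -/
def G181 : Matrix (Tor (fine n M) × Fin d) (Tor (fine n M) × Fin d) ℂ :=
  (LapVinv n M - (a : ℂ) • (LapVinv n M * QvAdj n M * Phi176Inv n M a * QvOp n M * LapVinv n M))
    + K181adj n M a * ((a : ℂ)⁻¹ • GPhiEInv n M a) * K181 n M a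

/-- `G181 J = Δ⁻¹J − aΔ⁻¹Q*φ⁻¹QΔ⁻¹J + […]*(a⁻¹(∂₁*φ⁻¹∂₁)⁻¹([…]J))`. [cite: Balaban1984PropagatorsI, (1.81) p.31] -/
theorem G181_mulVec (J : Tor (fine n M) × Fin d → ℂ) :
    G181 n M a *ᵥ J
      = LapVinv n M *ᵥ J
        - (a : ℂ) • (LapVinv n M *ᵥ (QvAdj n M *ᵥ (Phi176Inv n M a *ᵥ (QvOp n M *ᵥ (LapVinv n M *ᵥ J)))))
        + K181adj n M a *ᵥ ((a : ℂ)⁻¹ • (GPhiEInv n M a *ᵥ (K181 n M a *ᵥ J))) := by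
  simp only [G181, Matrix.add_mulVec, Matrix.sub_mulVec, Matrix.smul_mulVec, ← Matrix.mulVec_mulVec]

/-! ## §2 (1.81): `G` on `J ⊥ 1` -/

/-- **(1.81)** «A = (Δ⁻¹ − aΔ⁻¹Q*φ⁻¹QΔ⁻¹)J + [(Q′Δ⁻²Q′*)⁻¹Q′Δ⁻²∂* − a∂₁*φ⁻¹QΔ⁻¹]*a⁻¹(∂₁*φ⁻¹∂₁)⁻¹
[(Q′Δ⁻²Q′*)⁻¹Q′Δ⁻²∂* − a∂₁*φ⁻¹QΔ⁻¹]J for J satisfying ⟨1, J_μ⟩ = 0», with `A = GJ = Δ_a⁻¹J`, `a > 0` —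
«Substituting it [(1.80)] in Eq. (1.78)»: by `B5Eq178Torus.eq178` and `B5Eq194DivG.eq180`, the bracket of (1.80) being
`a⁻¹[…]J`. [cite: Balaban1984PropagatorsI, (1.81) p.31] -/
theorem eq181 (ha : 0 < a) (J : Tor (fine n M) × Fin d → ℂ) (hJ : OrthConst (fine n M) J) :
    (DeltaA n M a)⁻¹ *ᵥ J = G181 n M a *ᵥ J := by
  have hn : 1 ≤ n := Nat.one_le_iff_ne_zero.mpr (NeZero.ne n)
  have ha' : (a : ℂ) ≠ 0 := by exact_mod_cast ha.ne'
  have hdet := (Matrix.isUnit_iff_isUnit_det _).mp (isUnit_DeltaA n hn M a ha)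
  set A : Tor (fine n M) × Fin d → ℂ := (DeltaA n M a)⁻¹ *ᵥ J with hAdef
  have hA : DeltaA n M a *ᵥ A = J := by
    rw [hAdef, Matrix.mulVec_mulVec, Matrix.mul_nonsing_inv _ hdet, Matrix.one_mulVec]
  have hAo : OrthConst (fine n M) A := orthConst_of_DeltaA_eq n M a ha.ne' hJ hA
  have h178 := eq178 n M a ha.le hA hAo
  -- (1.80): `Q′Δ⁻¹∂*A = (∂₁*φ⁻¹∂₁)⁻¹·a⁻¹[…]J`
  have hu : QsOp n M *ᵥ (LapSinv (fine n M) (n : ℂ) *ᵥ ((GradOp (fine n M) (n : ℂ))ᴴ *ᵥ A))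
      = (a : ℂ)⁻¹ • (GPhiEInv n M a *ᵥ (K181 n M a *ᵥ J)) := by
    rw [← Matrix.mulVec_smul, K181_mulVec, smul_sub, smul_smul, inv_mul_cancel₀ ha', one_smul]
    exact eq180 n M a ha hA hAo
  rw [G181_mulVec, ← hu, K181adj_mulVec]
  -- regroup (1.78)
  have key : ∀ (B X1 X2 X3 L : Tor (fine n M) × Fin d → ℂ),
      B - X1 + (a : ℂ) • X2 + (a : ℂ) • X3 = L → B = L - (a : ℂ) • X3 + (X1 - (a : ℂ) • X2) := by
    intro B X1 X2 X3 L h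
    rw [← h]
    abel
  exact key _ _ _ _ _ h178

/-- (1.81) with `A` THE SOLUTION of (1.73): if `Δ_aA = J` and `J ⊥` constants then `A = G181 J` (`a > 0`).
[cite: Balaban1984PropagatorsI, (1.81) p.31, (1.73) p.30] -/
theorem eq181_of_solution (ha : 0 < a) {A J : Tor (fine n M) × Fin d → ℂ} (hA : DeltaA n M a *ᵥ A = J)
    (hJ : OrthConst (fine n M) J) : A = G181 n M a *ᵥ J := by
  have hn : 1 ≤ n := Nat.one_le_iff_ne_zero.mpr (NeZero.ne n)
  have hdet := (Matrix.isUnit_iff_isUnit_det _).mp (isUnit_DeltaA n hn M a ha)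
  have hA' : A = (DeltaA n M a)⁻¹ *ᵥ J := by
    rw [← hA, Matrix.mulVec_mulVec, Matrix.nonsing_inv_mul _ hdet, Matrix.one_mulVec]
  rw [hA', eq181 n M a ha J hJ]

/-- «Then the solution A satisfies also ⟨1, A_μ⟩ = 0»: `GJ ⊥` constants for `J ⊥` constants ((1.74); `a > 0`).
[cite: Balaban1984PropagatorsI, p.31 after (1.81), (1.74) p.30] -/
theorem orthConst_G_mulVec (ha : 0 < a) {J : Tor (fine n M) × Fin d → ℂ} (hJ : OrthConst (fine n M) J) :
    OrthConst (fine n M) ((DeltaA n M a)⁻¹ *ᵥ J) := by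
  have hn : 1 ≤ n := Nat.one_le_iff_ne_zero.mpr (NeZero.ne n)
  have hdet := (Matrix.isUnit_iff_isUnit_det _).mp (isUnit_DeltaA n hn M a ha)
  have hA : DeltaA n M a *ᵥ ((DeltaA n M a)⁻¹ *ᵥ J) = J := by
    rw [Matrix.mulVec_mulVec, Matrix.mul_nonsing_inv _ hdet, Matrix.one_mulVec]
  exact orthConst_of_DeltaA_eq n M a ha.ne' hJ hA

/-- the right-hand side of (1.81) lands in the subspace «orthogonal to constant functions» for EVERY `J`
(each term is a `Δ⁻¹(…)` or a `∂(…)`). [cite: Balaban1984PropagatorsI, p.31 after (1.81)] -/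
theorem orthConst_G181_mulVec (J : Tor (fine n M) × Fin d → ℂ) : OrthConst (fine n M) (G181 n M a *ᵥ J) := by
  rw [G181_mulVec, K181adj_mulVec]
  refine orthConst_add (orthConst_sub (fine n M) (orthConst_LapVinv n M J)
    (orthConst_smul _ (orthConst_LapVinv n M _)))
    (orthConst_sub (fine n M) (orthConst_GradOp (fine n M) (n : ℂ) _)
      (orthConst_smul _ (orthConst_LapVinv n M _)))

/-! ## §3 (1.82): `GJ = GJ′ + a⁻¹J₀`, «so G = Δ_a⁻¹», and the bridge to (1.83) -/

/-- **(1.82) AS AN OPERATOR**: `G182 = G181·(1 − P₀) + a⁻¹P₀` — «For arbitrary J we take the decomposition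
J = J′ + J₀, J₀ constant, J′ orthogonal to constant functions, and we put GJ = GJ′ + a⁻¹J₀» (`P₀J = J₀`,
`(1 − P₀)J = J′`). [cite: Balaban1984PropagatorsI, (1.82) p.31] -/
def G182 : Matrix (Tor (fine n M) × Fin d) (Tor (fine n M) × Fin d) ℂ :=
  G181 n M a * (1 - P0M (fine n M)) + (a : ℂ)⁻¹ • P0M (fine n M)

/-- **(1.82)** «GJ = GJ′ + a⁻¹J₀» for EVERY `J`, with `GJ′` given by (1.81) (`J′ ⊥ 1`) and `GJ₀ = a⁻¹J₀`
(`B5Phi176Torus.G_constV`); `a > 0`. [cite: Balaban1984PropagatorsI, (1.82) p.31] -/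
theorem eq182_mulVec (ha : 0 < a) (J : Tor (fine n M) × Fin d → ℂ) :
    (DeltaA n M a)⁻¹ *ᵥ J = G181 n M a *ᵥ Bp (fine n M) J + (a : ℂ)⁻¹ • B0 (fine n M) J := by
  conv_lhs => rw [← Bp_add_B0 (fine n M) J]
  rw [Matrix.mulVec_add, eq181 n M a ha _ (orthConst_Bp (fine n M) J)]
  unfold B0
  rw [G_constV n M a ha]

/-- **(1.82) as a matrix identity: `G = Δ_a⁻¹ = G181(1 − P₀) + a⁻¹P₀`** (`a > 0`).
[cite: Balaban1984PropagatorsI, (1.82) p.31] -/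
theorem eq182 (ha : 0 < a) : (DeltaA n M a)⁻¹ = G182 n M a :=
  ext_of_mulVec' fun J => by
    rw [eq182_mulVec n M a ha J, G182, Matrix.add_mulVec, Matrix.smul_mulVec, ← Matrix.mulVec_mulVec,
      Matrix.sub_mulVec, Matrix.one_mulVec, P0M_mulVec]
    rfl

/-- **«This gives the solution of Eq. (1.73)»**: `Δ_a(G182 J) = J` for every `J` (`a > 0`).
[cite: Balaban1984PropagatorsI, p.31 after (1.82), (1.73) p.30] -/
theorem DeltaA_G182_mulVec (ha : 0 < a) (J : Tor (fine n M) × Fin d → ℂ) :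
    DeltaA n M a *ᵥ (G182 n M a *ᵥ J) = J := by
  have hn : 1 ≤ n := Nat.one_le_iff_ne_zero.mpr (NeZero.ne n)
  have hdet := (Matrix.isUnit_iff_isUnit_det _).mp (isUnit_DeltaA n hn M a ha)
  rw [← eq182 n M a ha, Matrix.mulVec_mulVec, Matrix.mul_nonsing_inv _ hdet, Matrix.one_mulVec]

/-- **«so G = Δ_a⁻¹»**, right inverse: `Δ_a·G182 = 1` (`a > 0`). [cite: Balaban1984PropagatorsI, p.31 after (1.82), (1.71) p.30] -/
theorem DeltaA_mul_G182 (ha : 0 < a) : DeltaA n M a * G182 n M a = 1 := by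
  have hn : 1 ≤ n := Nat.one_le_iff_ne_zero.mpr (NeZero.ne n)
  have hdet := (Matrix.isUnit_iff_isUnit_det _).mp (isUnit_DeltaA n hn M a ha)
  rw [← eq182 n M a ha, Matrix.mul_nonsing_inv _ hdet]

/-- **«so G = Δ_a⁻¹»**, left inverse: `G182·Δ_a = 1` (`a > 0`). [cite: Balaban1984PropagatorsI, p.31 after (1.82), (1.71) p.30] -/
theorem G182_mul_DeltaA (ha : 0 < a) : G182 n M a * DeltaA n M a = 1 := by
  have hn : 1 ≤ n := Nat.one_le_iff_ne_zero.mpr (NeZero.ne n)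
  have hdet := (Matrix.isUnit_iff_isUnit_det _).mp (isUnit_DeltaA n hn M a ha)
  rw [← eq182 n M a ha, Matrix.nonsing_inv_mul _ hdet]

/-- **(1.81)–(1.82) = (1.83)**: «To investigate better the operator G we write it in momentum
representation» — the position-space operator of (1.81)/(1.82) IS the operator `𝒢 = B5Prop11Plancherel.calG`
whose Fourier blocks over the cosets `p = p′ + l` are the matrices (1.83) (via `B5DeltaA169.calG_eq_DeltaA_inv`).
[cite: Balaban1984PropagatorsI, (1.82)–(1.83) p.31] -/
theorem G182_eq_calG (hn : 1 ≤ n) (ha : 0 < a) : G182 n M a = calG n hn M a ha := by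
  rw [calG_eq_DeltaA_inv, eq182 n M a ha]

end

end Literature.MathematicalPhysics.QuantumFieldTheory.Balaban1983to89.B5Eq181GTorus
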